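import Mathlib
import Summits.KontsevichZagierPeriods.Zeta5Search.BrickTwoDigitMain

/-!
# BrickTwoDigitAll — THE TWO-DIGIT FACTORISATION (E1⁺) FOR EVERY DIGIT CELL `j ≤ n < p²`:
`p^{A−s}·c_{j,s}(n) ≡ c_{j₀,A}(n₀)·c̃_{j₁,s}(n₁) (mod p)`, `n = n₁p + n₀`, `j = j₁p + j₀` (zi-p2 THEOREM 6 Step E⁺
complete: main case + the vanishing cases (a1)–(a4) + the centre; cell zeta5-irr)

HONEST FRAMING: systematic search; no irrationality claim unless certified. INSTRUMENT lemma of the ζ(5)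
census cell zeta5-irr (HOME `run/shared/lean/pub/zeta5-irr/`; memo `zi-p2/probes/B8/thm6/THEOREM6.md` Step E⁺
«(E1⁺) `ρ_j^{(s)} ≡ c_{j_0,A}(n_0)·cell̃^{(s)}_{j_1}(n_1) (mod p)` with `c_{j_0,A}(n_0) := 0` for `j_0 > n_0` … (a)
VANISHING CASES (a1) `j_0 > n_0` … (a2) `n_0 + j_0 ≥ p` … (a3) `(n_0−j_0) + n_0 ≥ p` … (a4) `p | (n − 2j)` … In all
vanishing cases both sides of (E1⁺) are 0. (b) MAIN CASE»). Nothing here is about ζ(5); no irrationality content;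
filing moves no rung. Filed by the engine seat zi-eng (g8); sequel of `BrickTwoDigitMain` (main case),
`BrickCellValuation`/`BrickTopKummer` (compensated valuations), Mathlib's Kummer and Lucas theorems.

## The statement

`p` odd prime, `2 ≤ 2B ≤ A` (`B ≥ 1`), the centred brick kernel `ε = 1`, `j ≤ n < p²`, digits `n₀ = n % p`,
`n₁ = n / p`, `j₀ = j % p`, `j₁ = j / p`. For every depth `d` (`laurent_two_digit_all`):

**`v_p(p^d·laurent A B 1 n j d − cTop A B 1 n₀ j₀ · laurent A B 0 n₁ j₁ d) ≥ 1`**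

(`cell_two_digit_all`: `d = A − s`), where `cTop A B 1 n₀ j₀ = c_{j₀,A}(n₀)` is LITERALLY `0` for `j₀ > n₀`
(`C(n₀,j₀) = 0`) and for `n₀ = 2j₀`. Tools: `two_digits_le_padicValNat_choose_add` (Kummer at digit positions 0 and 1:
`[p ≤ n%p + k%p] + [p² ≤ n+k] ≤ v_p(C(n+k,k))` for `n, k < p²`), `padicValuation_cTop_one` (product formula),
`cTop_one_digit_lt` (the one-digit coefficient vanishes mod `p` off the main case), `pow_mul_laurent_lt`
(`v_p(p^d c_{j,A−d}(n)) ≥ 1` off the main case: an uncompensated carry, or the centre).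
-/

namespace Summit.KontsevichZagierPeriods.Zeta5Search.BrickTwoDigitAll

open Finset Nat WithZero
open Summit.KontsevichZagierPeriods.Zeta5Search.BrickTopCoefficient (cTop)
open Summit.KontsevichZagierPeriods.Zeta5Search.BrickLaurent (laurent cell)
open Summit.KontsevichZagierPeriods.Zeta5Search.BrickLaurentValuation (laurent_centre)
open Summit.KontsevichZagierPeriods.Zeta5Search.BrickCellValuation (sigmaTop laurent_valuation)
open Summit.KontsevichZagierPeriods.Zeta5Search.BrickTopKummer (one_le_padicValNat_choose_add
  padicValuation_natCast_le_exp_neg padicValuation_choose_add_le laurent_valuation_abs)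
open Summit.KontsevichZagierPeriods.Zeta5Search.BrickLambda (padicValuation_two)
open Summit.KontsevichZagierPeriods.Zeta5Search.BrickTwoDigitMain (laurent_two_digit)
open Literature.NumberTheory.LFunctions (padicValuation_natCast_le_one)

noncomputable section

variable {p : ℕ} [Fact p.Prime]

/-! ## Kummer at two digit positions; valuation of the top coefficient -/

/-- **Kummer, digits 0 and 1**: for `n, k < p²`, `[p ≤ n % p + k % p] + [p² ≤ n + k] ≤ v_p(C(n+k, k))`. -/
theorem two_digits_le_padicValNat_choose_add {n k : ℕ} (hn : n < p ^ 2) (hk : k < p ^ 2) :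
    (if p ≤ n % p + k % p then 1 else 0) + (if p ^ 2 ≤ n + k then 1 else 0) ≤ padicValNat p ((n + k).choose k) := by
  have hp : p.Prime := Fact.out
  rcases Nat.eq_zero_or_pos (n + k) with h0 | h0
  · have hn0 : n = 0 := by omega
    have hk0 : k = 0 := by omega
    subst hn0; subst hk0
    rw [if_neg (by simpa using hp.ne_zero), if_neg (by simpa using hp.ne_zero)]
    exact Nat.zero_le _
  have hb : Nat.log p (n + k) < 3 := by
    refine Nat.log_lt_of_lt_pow (by omega) ?_
    calc n + k < 2 * p ^ 2 := by omega
      _ ≤ p * p ^ 2 := Nat.mul_le_mul_right _ hp.two_le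
      _ = p ^ 3 := by ring
  rw [padicValNat_choose' hb]
  have h1 : p ≤ n % p + k % p → 1 ∈ (Finset.Ico 1 3).filter (fun i => p ^ i ≤ k % p ^ i + n % p ^ i) := fun h =>
    mem_filter.2 ⟨by simp, by rw [pow_one]; omega⟩
  have h2 : p ^ 2 ≤ n + k → 2 ∈ (Finset.Ico 1 3).filter (fun i => p ^ i ≤ k % p ^ i + n % p ^ i) := fun h =>
    mem_filter.2 ⟨by simp, by rw [Nat.mod_eq_of_lt hk, Nat.mod_eq_of_lt hn]; omega⟩
  split_ifs with c1 c2 c2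
  · calc 1 + 1 = ({1, 2} : Finset ℕ).card := by rfl
      _ ≤ _ := card_le_card fun i hi => by
          simp only [mem_insert, mem_singleton] at hi
          rcases hi with rfl | rfl
          exacts [h1 c1, h2 c2]
  · exact card_pos.2 ⟨1, h1 c1⟩
  · exact card_pos.2 ⟨2, h2 c2⟩
  · exact Nat.zero_le _

/-- Valuation form: `v(C(n+k,k)) ≤ exp(−[p ≤ n%p + k%p] − [p² ≤ n+k])` for `n, k < p²`. -/
theorem padicValuation_choose_add_two_digits {n k : ℕ} (hn : n < p ^ 2) (hk : k < p ^ 2) :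
    Rat.padicValuation p (((n + k).choose k : ℕ) : ℚ) ≤
      exp (-(((if p ≤ n % p + k % p then 1 else 0) + (if p ^ 2 ≤ n + k then 1 else 0) : ℕ) : ℤ)) :=
  padicValuation_natCast_le_exp_neg (Nat.choose_pos (Nat.le_add_left k n)).ne'
    (two_digits_le_padicValNat_choose_add hn hk)

/-- The product formula `v(c_{j,A}(n)) = v(n/2 − j)·v(C(n,j))^A·(v(C(n+j,j))·v(C(2n−j,n)))^B` (`ε = 1`). -/
theorem padicValuation_cTop_one (A B n j : ℕ) : Rat.padicValuation p (cTop A B 1 n j) =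
    Rat.padicValuation p ((n : ℚ) / 2 - j) * Rat.padicValuation p (n.choose j : ℚ) ^ A *
      (Rat.padicValuation p ((n + j).choose j : ℚ) * Rat.padicValuation p ((2 * n - j).choose n : ℚ)) ^ B := by
  unfold cTop
  rw [map_mul, map_mul, map_mul, map_pow, Valuation.map_neg, map_one, one_pow, one_mul, pow_one, map_pow, map_pow,
    map_mul]

/-- The centre offset is `p`-integral (odd `p`). -/
theorem padicValuation_centre_le_one (hp2 : p ≠ 2) (n j : ℕ) : Rat.padicValuation p ((n : ℚ) / 2 - j) ≤ 1 := by
  rw [show (n : ℚ) / 2 - j = (((n : ℤ) - 2 * j : ℤ) : ℚ) / 2 by push_cast; ring, map_div₀, padicValuation_two hp2,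
    div_one, Rat.padicValuation_cast]
  exact Int.padicValuation_le_one _ _

omit [Fact p.Prime] in
/-- Monotonicity of `exp(−·)` on naturals. -/
theorem exp_neg_mono {a b : ℕ} (h : b ≤ a) : exp (-(a : ℤ)) ≤ exp (-(b : ℤ)) := exp_le_exp.2 (by omega)

/-! ## Off the main case both sides vanish mod `p` -/

section all

variable (hp2 : p ≠ 2) {A B n j : ℕ} (hAB : 2 * B ≤ A) (hB : 1 ≤ B) (hn : n < p ^ 2) (hj : j ≤ n)
include hp2 hAB hB

/-- The ONE-DIGIT coefficient `c_{j₀,A}(n₀)` vanishes mod `p` off the main case. -/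
theorem cTop_one_digit_lt
    (hcase : ¬ (j % p ≤ n % p ∧ n % p + j % p < p ∧ n % p + (n % p - j % p) < p ∧ ¬ (p : ℤ) ∣ (n : ℤ) - 2 * j)) :
    Rat.padicValuation p (cTop A B 1 (n % p) (j % p)) < 1 := by
  have hp : p.Prime := Fact.out
  have hA : A ≠ 0 := by omega
  have hn₀ : n % p < p := Nat.mod_lt _ hp.pos
  have hj₀ : j % p < p := Nat.mod_lt _ hp.pos
  by_cases ha1 : n % p < j % p
  · rw [cTop, Nat.choose_eq_zero_of_lt ha1, Nat.cast_zero, zero_pow hA, mul_zero, zero_mul, map_zero]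
    exact zero_lt_one
  rw [padicValuation_cTop_one]
  have hcen := padicValuation_centre_le_one (p := p) hp2 (n % p) (j % p)
  have hC : ∀ c : ℕ, Rat.padicValuation p (c : ℚ) ≤ 1 := fun c => padicValuation_natCast_le_one c
  by_cases ha2 : p ≤ n % p + j % p
  · have h := padicValuation_natCast_le_exp_neg (p := p) (Nat.choose_pos (Nat.le_add_left (j % p) (n % p))).ne'
      (one_le_padicValNat_choose_add (L := 0) (by simpa using hn₀) (by simpa using hj₀) (by simpa using ha2))
    calc _ ≤ 1 * 1 ^ A * (exp (-((1 : ℕ) : ℤ)) * 1) ^ B :=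
          mul_le_mul' (mul_le_mul' hcen (pow_le_pow_left' (hC _) A)) (pow_le_pow_left' (mul_le_mul' h (hC _)) B)
      _ < 1 := by
          rw [one_pow, one_mul, one_mul, mul_one, ← exp_nsmul, ← exp_zero, exp_lt_exp]; simp; omega
  by_cases ha3 : p ≤ n % p + (n % p - j % p)
  · have h := padicValuation_natCast_le_exp_neg (p := p) (Nat.choose_pos (Nat.le_add_left (n % p) (n % p - j % p))).ne'
      (one_le_padicValNat_choose_add (L := 0) (n := n % p - j % p) (k := n % p) (by simp; omega) (by simpa using hn₀)
        (by rw [pow_one]; omega))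
    rw [show n % p - j % p + n % p = 2 * (n % p) - j % p by omega] at h
    calc _ ≤ 1 * 1 ^ A * (1 * exp (-((1 : ℕ) : ℤ))) ^ B :=
          mul_le_mul' (mul_le_mul' hcen (pow_le_pow_left' (hC _) A)) (pow_le_pow_left' (mul_le_mul' (hC _) h) B)
      _ < 1 := by
          rw [one_pow, one_mul, one_mul, one_mul, ← exp_nsmul, ← exp_zero, exp_lt_exp]; simp; omega
  -- remaining: the three digit conditions hold, so `p ∣ n − 2j`, forcing `n₀ = 2j₀`
  have hdvd : (p : ℤ) ∣ (n : ℤ) - 2 * j := by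
    by_contra h
    exact hcase ⟨not_lt.1 ha1, not_le.1 ha2, not_le.1 ha3, h⟩
  have hdec : ((n : ℤ) - 2 * j) = ((n % p : ℕ) : ℤ) - 2 * ((j % p : ℕ) : ℤ) + (p : ℤ) * ((n / p : ℕ) - 2 * (j / p : ℕ)) := by
    have e1 : ((n % p : ℕ) : ℤ) + (p : ℤ) * ((n / p : ℕ) : ℤ) = n := by exact_mod_cast Nat.mod_add_div n p
    have e2 : ((j % p : ℕ) : ℤ) + (p : ℤ) * ((j / p : ℕ) : ℤ) = j := by exact_mod_cast Nat.mod_add_div j p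
    linear_combination -e1 + 2 * e2
  have hsmall : (p : ℤ) ∣ ((n % p : ℕ) : ℤ) - 2 * ((j % p : ℕ) : ℤ) := by
    have := hdvd; rw [hdec] at this
    exact (dvd_add_left (dvd_mul_right _ _)).1 this
  have hzero : ((n % p : ℕ) : ℤ) - 2 * ((j % p : ℕ) : ℤ) = 0 :=
    Int.eq_zero_of_dvd_of_natAbs_lt_natAbs hsmall (by omega)
  have hnat : n % p = 2 * (j % p) := by omega
  have : ((n % p : ℕ) : ℚ) / 2 - ((j % p : ℕ) : ℚ) = 0 := by rw [hnat]; push_cast; ring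
  rw [this, map_zero, zero_mul, zero_mul]
  exact zero_lt_one

include hn hj

/-- `v_p(p^d·c_{j,A−d}(n)) ≥ 1` off the main case (an uncompensated carry in `c_{j,A}(n)`, or the centre). -/
theorem pow_mul_laurent_lt
    (hcase : ¬ (j % p ≤ n % p ∧ n % p + j % p < p ∧ n % p + (n % p - j % p) < p ∧ ¬ (p : ℤ) ∣ (n : ℤ) - 2 * j))
    (d : ℕ) : Rat.padicValuation p ((p : ℚ) ^ d * laurent A B 1 n j d) < 1 := by
  have hp : p.Prime := Fact.out
  have hA : A ≠ 0 := by omega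
  have hn₀ : n % p < p := Nat.mod_lt _ hp.pos
  have hj₀ : j % p < p := Nat.mod_lt _ hp.pos
  have hjlt : j < p ^ 2 := lt_of_le_of_lt hj hn
  have hpd : Rat.padicValuation p ((p : ℚ) ^ d) = exp (-(d : ℤ)) := by
    rw [map_pow, Rat.padicValuation_self, ← exp_nsmul]; simp
  by_cases hc : 2 * j = n
  · -- the centre: pole of order `A − 1`
    rcases d with _ | d
    · rw [(laurent_centre A B hc 0).2, mul_zero, map_zero]; exact zero_lt_one
    · rw [(laurent_centre A B hc d).1, map_mul, hpd]
      have hv := laurent_valuation_abs (p := p) hp2 hAB (L := 1) (ε := 0) (by simpa using hn) hj (Or.inr rfl) d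
      refine (mul_le_mul' le_rfl hv).trans_lt ?_
      rw [← exp_add, ← exp_zero, exp_lt_exp]; push_cast; omega
  -- off-centre: the compensated bound, and one extra `p` in `c_{j,A}(n)`
  have hval := laurent_valuation (p := p) hAB (L := 1) (ε := 1) (by simpa using hn) hj (Or.inl hc) d
  rw [map_mul, hpd]
  refine (mul_le_mul' le_rfl hval).trans_lt ?_
  rw [mul_left_comm, ← exp_add, show -(d : ℤ) + ((1 : ℕ) * d + (B * sigmaTop p 1 n j : ℕ)) = (B * sigmaTop p 1 n j : ℕ) by
    push_cast; ring]
  -- it remains: v(cTop 1 n j) * exp(Bσ) < 1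
  rw [padicValuation_cTop_one]
  have hcen := padicValuation_centre_le_one (p := p) hp2 n j
  have hC : ∀ c : ℕ, Rat.padicValuation p (c : ℚ) ≤ 1 := fun c => padicValuation_natCast_le_one c
  -- the two distant-root indicators are always paid
  have hσ1 := padicValuation_choose_add_two_digits (p := p) hn hjlt
  have hσ2 : Rat.padicValuation p (((2 * n - j).choose n : ℕ) : ℚ) ≤
      exp (-(((if p ≤ (n - j) % p + n % p then 1 else 0) + (if p ^ 2 ≤ 2 * n - j then 1 else 0) : ℕ) : ℤ)) := by
    have h := padicValuation_choose_add_two_digits (p := p) (n := n - j) (k := n) (by omega) hn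
    rwa [show n - j + n = 2 * n - j by omega] at h
  have hσ : sigmaTop p 1 n j = (if p ^ 2 ≤ n + j then 1 else 0) + (if p ^ 2 ≤ 2 * n - j then 1 else 0) := rfl
  -- generic finishing move: if v(cen)·v(C(n,j))^A ≤ exp(−e₀) and the numerator binomials pay `e₁ + e₂` beyond σ with
  -- `e₀ + B(e₁+e₂) ≥ 1`, we are done
  have finish : ∀ (e₀ e₁ e₂ : ℕ), 1 ≤ e₀ + B * (e₁ + e₂) →
      Rat.padicValuation p ((n : ℚ) / 2 - j) * Rat.padicValuation p (n.choose j : ℚ) ^ A ≤ exp (-(e₀ : ℤ)) →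
      Rat.padicValuation p (((n + j).choose j : ℕ) : ℚ) ≤ exp (-((e₁ + (if p ^ 2 ≤ n + j then 1 else 0) : ℕ) : ℤ)) →
      Rat.padicValuation p (((2 * n - j).choose n : ℕ) : ℚ) ≤ exp (-((e₂ + (if p ^ 2 ≤ 2 * n - j then 1 else 0) : ℕ) : ℤ)) →
      Rat.padicValuation p ((n : ℚ) / 2 - j) * Rat.padicValuation p (n.choose j : ℚ) ^ A *
        (Rat.padicValuation p (((n + j).choose j : ℕ) : ℚ) * Rat.padicValuation p (((2 * n - j).choose n : ℕ) : ℚ)) ^ B *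
        exp (((B * sigmaTop p 1 n j : ℕ) : ℤ)) < 1 := by
    intro e₀ e₁ e₂ hsum h0 h1' h2'
    calc _ ≤ exp (-(e₀ : ℤ)) * (exp (-((e₁ + (if p ^ 2 ≤ n + j then 1 else 0) : ℕ) : ℤ)) *
          exp (-((e₂ + (if p ^ 2 ≤ 2 * n - j then 1 else 0) : ℕ) : ℤ))) ^ B * exp (((B * sigmaTop p 1 n j : ℕ) : ℤ)) :=
          mul_le_mul' (mul_le_mul' h0 (pow_le_pow_left' (mul_le_mul' h1' h2') B)) le_rfl
      _ < 1 := by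
          rw [← exp_add, ← exp_nsmul, ← exp_add, ← exp_add, ← exp_zero, exp_lt_exp, hσ, nsmul_eq_mul]
          push_cast
          have hsum' : (1 : ℤ) ≤ e₀ + B * (e₁ + e₂) := by exact_mod_cast hsum
          nlinarith [hsum']
  by_cases ha1 : n % p < j % p
  · -- (a1): Lucas gives `p ∣ C(n,j)`
    have hdvd : p ∣ n.choose j := by
      have h := (Choose.choose_modEq_choose_mod_mul_choose_div_nat (n := n) (k := j) (p := p))
      rw [Nat.choose_eq_zero_of_lt ha1, zero_mul] at h
      exact (Nat.modEq_zero_iff_dvd.1 h)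
    refine finish 1 0 0 (by omega) ?_ (hσ1.trans (exp_neg_mono (Nat.add_le_add_right (Nat.zero_le _) _)))
      (hσ2.trans (exp_neg_mono (Nat.add_le_add_right (Nat.zero_le _) _)))
    have h := padicValuation_natCast_le_exp_neg (p := p) (Nat.choose_pos hj).ne'
      ((padicValNat_dvd_iff_le (Nat.choose_pos hj).ne').1 (by rwa [pow_one]))
    calc _ ≤ 1 * exp (-((1 : ℕ) : ℤ)) ^ A := mul_le_mul' hcen (pow_le_pow_left' h A)
      _ ≤ exp (-((1 : ℕ) : ℤ)) := by
          rw [one_mul, ← exp_nsmul, exp_le_exp]; simp; omega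
  by_cases ha2 : p ≤ n % p + j % p
  · -- (a2): carry at digit 0 of `n + j`
    refine finish 0 1 0 (by omega) ?_ (hσ1.trans (exp_neg_mono (by rw [if_pos ha2])))
      (hσ2.trans (exp_neg_mono (Nat.add_le_add_right (Nat.zero_le _) _)))
    rw [Nat.cast_zero, neg_zero, exp_zero]; exact mul_le_one' hcen (pow_le_one' (hC _) _)
  by_cases ha3 : p ≤ n % p + (n % p - j % p)
  · -- (a3): carry at digit 0 of `(n − j) + n`
    have hmod : (n - j) % p = n % p - j % p := by
      have e1 := Nat.mod_add_div n p
      have e2 := Nat.mod_add_div j p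
      have hJN : j / p ≤ n / p := Nat.div_le_div_right hj
      have hmul : p * (j / p) ≤ p * (n / p) := Nat.mul_le_mul_left p hJN
      have hsub : n - j = (n % p - j % p) + p * (n / p - j / p) := by
        rw [Nat.mul_sub]; omega
      rw [hsub, Nat.add_mul_mod_self_left, Nat.mod_eq_of_lt (by omega)]
    have hcond : p ≤ (n - j) % p + n % p := by rw [hmod]; omega
    refine finish 0 0 1 (by omega) ?_ (hσ1.trans (exp_neg_mono (Nat.add_le_add_right (Nat.zero_le _) _)))
      (hσ2.trans (exp_neg_mono (by rw [if_pos hcond])))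
    rw [Nat.cast_zero, neg_zero, exp_zero]; exact mul_le_one' hcen (pow_le_one' (hC _) _)
  -- (a4): `p ∣ n − 2j`, `2j ≠ n`: the centre offset pays
  have hdvd : (p : ℤ) ∣ (n : ℤ) - 2 * j := by
    by_contra h
    exact hcase ⟨not_lt.1 ha1, not_le.1 ha2, not_le.1 ha3, h⟩
  have hz : ((n : ℤ) - 2 * j) ≠ 0 := fun h => hc (by omega)
  refine finish 1 0 0 (by omega) ?_ (hσ1.trans (exp_neg_mono (Nat.add_le_add_right (Nat.zero_le _) _)))
    (hσ2.trans (exp_neg_mono (Nat.add_le_add_right (Nat.zero_le _) _)))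
  have hv : 1 ≤ padicValInt p ((n : ℤ) - 2 * j) := by
    rcases (padicValInt_dvd_iff 1 ((n : ℤ) - 2 * j)).1 (by rwa [pow_one]) with h | h
    · exact absurd h hz
    · exact h
  have hcen' : Rat.padicValuation p ((n : ℚ) / 2 - j) ≤ exp (-((1 : ℕ) : ℤ)) := by
    rw [show (n : ℚ) / 2 - j = (((n : ℤ) - 2 * j : ℤ) : ℚ) / 2 by push_cast; ring, map_div₀, padicValuation_two hp2,
      div_one]
    have hq : (((n : ℤ) - 2 * j : ℤ) : ℚ) ≠ 0 := by exact_mod_cast hz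
    rw [show Rat.padicValuation p ((((n : ℤ) - 2 * j : ℤ)) : ℚ) = exp (-padicValRat p ((((n : ℤ) - 2 * j : ℤ)) : ℚ))
      from if_neg hq, padicValRat.of_int, exp_le_exp]
    push_cast; omega
  calc _ ≤ exp (-((1 : ℕ) : ℤ)) * 1 := mul_le_mul' hcen' (pow_le_one' (hC _) _)
    _ = _ := mul_one _

/-- **(E1⁺) FOR EVERY DIGIT CELL**, depth form: `j ≤ n < p²`, odd `p`, `2 ≤ 2B ≤ A`:
`v_p(p^d·laurent A B 1 n j d − cTop A B 1 (n%p) (j%p)·laurent A B 0 (n/p) (j/p) d) ≥ 1`. -/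
theorem laurent_two_digit_all (d : ℕ) :
    Rat.padicValuation p ((p : ℚ) ^ d * laurent A B 1 n j d -
      cTop A B 1 (n % p) (j % p) * laurent A B 0 (n / p) (j / p) d) < 1 := by
  have hp : p.Prime := Fact.out
  have hn' : n = n % p + n / p * p := by rw [mul_comm]; exact (Nat.mod_add_div n p).symm
  have hj' : j = j % p + j / p * p := by rw [mul_comm]; exact (Nat.mod_add_div j p).symm
  have hN : n / p < p := Nat.div_lt_of_lt_mul (by rw [← pow_two]; exact hn)
  have hJN : j / p ≤ n / p := Nat.div_le_div_right hj
  by_cases hmain : j % p ≤ n % p ∧ n % p + j % p < p ∧ n % p + (n % p - j % p) < p ∧ ¬ (p : ℤ) ∣ (n : ℤ) - 2 * j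
  · exact laurent_two_digit hp2 hAB hn' hj' hN hmain.1 hmain.2.1 hmain.2.2.1 hJN (Or.inr hmain.2.2.2) d
  · have hcell : Rat.padicValuation p (laurent A B 0 (n / p) (j / p) d) ≤ 1 := by
      have h := laurent_valuation_abs (p := p) hp2 hAB (L := 0) (ε := 0) (by simpa using hN) hJN (Or.inr rfl) d
      rwa [Nat.cast_zero, zero_mul, exp_zero] at h
    refine (Valuation.map_sub _ _ _).trans_lt (max_lt (pow_mul_laurent_lt hp2 hAB hB hn hj hmain d) ?_)
    rw [map_mul]
    exact (mul_le_mul' le_rfl hcell).trans_lt (by rw [mul_one]; exact cTop_one_digit_lt hp2 hAB hB hmain)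

/-- **(E1⁺) FOR EVERY DIGIT CELL**, cell form: `p^{A−s}·c_{j,s}(n) ≡ c_{j₀,A}(n₀)·c̃_{j₁,s}(n₁) (mod p)`. -/
theorem cell_two_digit_all (s : ℕ) :
    Rat.padicValuation p ((p : ℚ) ^ (A - s) * cell A B 1 n j s -
      cTop A B 1 (n % p) (j % p) * cell A B 0 (n / p) (j / p) s) < 1 :=
  laurent_two_digit_all hp2 hAB hB hn hj (A - s)

end all

end

end Summit.KontsevichZagierPeriods.Zeta5Search.BrickTwoDigitAll
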